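import Mathlib.Data.Nat.Basic
import HarnessLib

/-!
# THETA tier-2 kernel checker — the sine-aware CELLWISE envelope in 2⁹⁶ fixed-point `ℕ` arithmetic (cc-s2-1, WEIL typing lane; RH-FREE bookkeeping)

Tier 2 of the theta certificate (THETA-CERT-cc6 §E, cc-s2-6; same B-spline theta witness as tier 1 = `ThetaTier1*`, but the Poisson
majorant `(m/ζ*)^m·ζ(m+1)` of D1/D2 replaced by the cellwise envelope E1–E5: depth cells `[jτ,(j+1)τ]`, `K` harmonics with a certified
`sup |sin|` per cell, `A = ‖T⁻‖²`, `B = ‖(T⁻)′‖²` as cell sums, the D6 cross term as a lag-cell CONVOLUTION with a decreasing hull summed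
by parts against `ψ(x) ≤ C·x` on `[N, ∞)`).  It is the engine that reaches the TWIN primes (`q⁺ = q + 2`) of the route items
`WallsTenKTwin` (stmt-RiemannHypothesis-19172) and the residual of `WallsSixtyKTwin` (19185) below the zero-dodger floor.

THIS FILE: the pure arithmetic, exactly the functions of the timing prototype HOME/cc-s2-1/gen22/tier2/T2Proto.lean (kernel-measured
≈ 12 s per row at `τ = 1/100`, bit-identical to the Python twin t2fix.py and, where the formulas coincide, to cc-s2-6's rational
`certify2`): every quantity is a natural number READ AS `x / 2⁹⁶`; fields/values suffixed `H` are UPPER bounds of the real they stand for,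
`L` LOWER bounds (HOME/cc-s2-1/gen22/TIER2-KERNEL-SPEC.md §1–§2 is the contract, discharged by `ThetaTier2Round` (rounding lemmas),
`ThetaTier2Sin` (the `sup|sin|` lemma) and the soundness file).  No real number appears here; nothing here bears on the truth of RH.
-/

set_option linter.dupNamespace false  -- the mandated namespace repeats `RiemannHypothesis`
set_option autoImplicit false

namespace Summit.RiemannHypothesis.RiemannHypothesis.Theorems.ThetaTier2

/-- the scale 2^96 -/
def S : Nat := 79228162514264337593543950336

/-- `⌈a·b / S⌉`: upper product. [this cell, TIER2-KERNEL-SPEC §0] -/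
def mulU (a b : Nat) : Nat := (a * b + (S - 1)) / S
/-- `⌊a·b / S⌋`: lower product. [this cell, TIER2-KERNEL-SPEC §0] -/
def mulD (a b : Nat) : Nat := a * b / S
/-- `⌈a·S / b⌉`: upper quotient of two scaled values. [this cell, TIER2-KERNEL-SPEC §0] -/
def divU (a b : Nat) : Nat := (a * S + (b - 1)) / b
/-- `⌈a / n⌉` for a plain natural `n`. [this cell, TIER2-KERNEL-SPEC §0] -/
def divUn (a n : Nat) : Nat := (a + (n - 1)) / n
/-- upper power `(x/S)^n` by iterated `mulU`. [this cell, TIER2-KERNEL-SPEC §0] -/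
def powU (x : Nat) : Nat → Nat
  | 0 => S
  | n + 1 => mulU (powU x n) x
/-- `|a − b|`. [this cell] -/
def absdiff (a b : Nat) : Nat := if a ≥ b then a - b else b - a

/-- upper bound of `S·sin(d/S)` for `0 ≤ d/S ≤ 79/50`, capped at `S` -/
def p5U (d : Nat) : Nat :=
  if d * 50 ≥ 79 * S then S else
  let d3 := (d * d * d) / (6 * S * S)
  let d5 := (d ^ 5 + (120 * S ^ 4 - 1)) / (120 * S ^ 4)
  let v := d - d3 + d5
  if v < S then v else S

/-- `max(|θ − nπ_L|, |θ − nπ_H|) ≥ |θ − nπ|` for the candidate multiple `n`. [this cell, TIER2-KERNEL-SPEC §2 LEMMA S] -/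
def cand (θ piL piH n : Nat) : Nat := max (absdiff θ (n * piL)) (absdiff θ (n * piH))

/-- upper bound of `dist(θ/S, πℤ)` (scaled) -/
def distU (θ piL piH : Nat) : Nat :=
  let n0 := θ / piH
  let b := min (cand θ piL piH n0) (min (cand θ piL piH (n0 + 1)) (cand θ piL piH (n0 + 2)))
  if n0 = 0 then b else min b (cand θ piL piH (n0 - 1))

/-- does `[(2n+1)π_L/2, (2n+1)π_H/2]` meet `[lo, hi]`? (then `(n+½)π` MAY lie in the cell). [this cell, TIER2-KERNEL-SPEC §2 LEMMA S] -/
def hit (lo hi piL piH n : Nat) : Bool :=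
  let a := ((2 * n + 1) * piL) / 2
  let b := ((2 * n + 1) * piH + 1) / 2
  !(decide (b < lo) || decide (a > hi))

/-- upper bound (scaled, ≤ S) of `sup_{θ ∈ [lo,hi]/S} |sin θ|` -/
def sinSup (lo hi0 piL piH : Nat) : Nat :=
  let hi := if hi0 < lo then lo else hi0
  if 2 * (hi - lo) ≥ piL then S else
  let n0 := hi / piH
  let cross := hit lo hi piL piH n0 || hit lo hi piL piH (n0 + 1) ||
    (if n0 ≥ 1 then hit lo hi piL piH (n0 - 1) else false) || (if n0 ≥ 2 then hit lo hi piL piH (n0 - 2) else false)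
  if cross then S else max (p5U (distU lo piL piH)) (p5U (distU hi piL piH))

/-- row inputs (all scaled naturals unless noted) -/
structure Inp where
  m : Nat
  K : Nat
  Jt : Nat
  Kw : Nat
  ncut : Nat
  j0 : Nat
  j1p : Nat      -- j1 + 1 (0 means: use zm1H)
  piL : Nat
  piH : Nat
  th0L : Nat
  th0H : Nat
  etL : Nat
  etH : Nat
  emhStep : Nat
  emStep : Nat
  em1Step : Nat
  ehStep : Nat
  eD2m1 : Nat
  eD2m : Nat
  eD2m_1 : Nat
  tau : Nat
  M0 : Nat
  Mbar : Nat
  M10 : Nat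
  Mbar1 : Nat
  u1H : Nat
  zm1H : Nat
  residm1 : Nat
  residm : Nat
  c2 : Nat
  eps : Nat
  cList : List Nat
  cpList : List Nat
  et0half : Nat
  t0 : Nat
  coefA : Nat
  lamSum : Nat
  GtailW : Nat
  tailInt : Nat
  Cpsi : Nat
  emL : Nat
  chiL : Nat
  rA : Nat
  rB : Nat
  rcoef : Nat
  logqL : Nat
  dJ : Nat
  gainPairs : List (Nat × Nat)

/-- harmonic loop: returns (Ssum, S1sum) for k = 1..K -/
def harm (A : Inp) (lo hi invlo : Nat) : Nat → Nat → Nat → Nat × Nat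
  | 0, sAcc, s1Acc => (sAcc, s1Acc)
  | fuel + 1, sAcc, s1Acc =>
    let k := A.K - fuel          -- k runs 1..K as fuel runs K-1..0 (called with fuel = K)
    let sk := sinSup (k * lo) (k * hi) A.piL A.piH
    let skm1 := powU sk (A.m - 1)
    let skm := mulU skm1 sk
    let sAcc' := sAcc + divUn skm (k ^ (A.m + 1))
    let term := mulU A.c2 skm + mulU (mulU A.eps skm1) (S + divUn invlo k)
    let s1Acc' := s1Acc + divUn term (k ^ A.m)
    harm A lo hi invlo fuel sAcc' s1Acc'

/-- loop state of the depth-cell stage -/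
structure St where
  lo : Nat
  hi : Nat
  emh : Nat
  em : Nat
  em1 : Nat
  eh : Nat
  eRev : List Nat     -- e_env reversed
  epRev : List Nat    -- ep_env reversed
  sRev : List Nat     -- S_j reversed

/-- One depth cell `j`: `S_j`, `S1_j` over the `K` harmonics (E1), cut factors (E2), envelopes `e_j`, `e′_j` (E3). [this cell, THETA-CERT-cc6 E1–E3] -/
def cellStep (A : Inp) (j : Nat) (st : St) : St :=
  let lo := st.lo
  let hiN := mulU st.hi A.etH
  let invlo := divU S lo
  let (sSum, s1Sum) := harm A lo hiN invlo A.K 0 0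
  let Sj := sSum + A.residm1
  let S1j := s1Sum + mulU A.residm (A.c2 + mulU A.eps (S + divUn invlo (A.K + 1)))
  let cj := if j < A.ncut then A.cList.getD j S else S
  let cpj := if j < A.ncut then A.cpList.getD j 0 else 0
  let ej := mulU (mulU st.emh Sj) cj
  let inner := mulU (divUn (mulU (mulU A.M0 st.em) Sj) 2 + mulU (mulU A.M10 st.em1) S1j) cj
    + mulU (mulU (mulU A.M0 st.em) Sj) cpj
  let epj := mulU st.eh inner
  { lo := mulD lo A.etL, hi := hiN,
    emh := mulU st.emh A.emhStep, em := mulU st.em A.emStep, em1 := mulU st.em1 A.em1Step, eh := mulU st.eh A.ehStep,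
    eRev := ej :: st.eRev, epRev := epj :: st.epRev, sRev := Sj :: st.sRev }

/-- The E3 loop over the depth cells `j = 0 … Jt−1`. [this cell] -/
def cellLoop (A : Inp) : Nat → Nat → St → St
  | 0, _, st => st
  | fuel + 1, j, st => cellLoop A fuel (j + 1) (cellStep A j st)

/-- Stage 1 = all depth cells from `θ₀` with the exponentials at `1`. [this cell, THETA-CERT-cc6 E3] -/
def stage1 (A : Inp) : St :=
  cellLoop A A.Jt 0 { lo := A.th0L, hi := A.th0H, emh := S, em := S, em1 := S, eh := S, eRev := [], epRev := [], sRev := [] }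

/-- `Σ ⌈e²⌉`. [this cell] -/
def sumSq : List Nat → Nat → Nat
  | [], acc => acc
  | e :: es, acc => sumSq es (acc + mulU e e)

/-- Stage-2 outputs: `A ≥ ‖T⁻‖²`, `B ≥ ‖(T⁻)′‖²`, the D7 arch bound, the D6 `C_T` part. [this cell, THETA-CERT-cc6 E3/D6/D7] -/
structure Mid where
  Ahi : Nat
  Bhi : Nat
  arch : Nat
  primesC : Nat

/-- Stage 2: `A`, `B` (E3 with the closed tails beyond depth `D`), `arch` (D7 at `t₀ = 2^-k`), `primesC` (D6). [this cell, THETA-CERT-cc6 E3/D6/D7] -/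
def stage2 (A : Inp) (st : St) : Mid :=
  let m := A.m
  let sumE2 := sumSq st.eRev 0
  let sumEp2 := sumSq st.epRev 0
  let M0sq := mulU A.M0 A.M0
  let Mbar2 := mulU A.Mbar A.Mbar
  let Ahi := mulU (2 * A.u1H) (mulU (mulU A.tau M0sq) sumE2 + divUn (mulU Mbar2 A.eD2m1) (2 * m + 1))
  let tailp := divUn (mulU (divUn Mbar2 4) A.eD2m1) (2 * m + 1) + divUn (mulU (mulU A.Mbar A.Mbar1) A.eD2m) (2 * m)
    + divUn (mulU (mulU A.Mbar1 A.Mbar1) A.eD2m_1) (2 * m - 1)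
  let Bhi := mulU (2 * A.u1H) (mulU A.tau sumEp2 + tailp)
  let arch := divUn (mulU (mulU (mulU Bhi A.et0half) A.t0) A.t0) 4 + mulU Ahi A.coefA
  let primesC := mulU (divUn (mulU (4 * Mbar2) A.u1H) (2 * m + 1)) A.lamSum
  { Ahi := Ahi, Bhi := Bhi, arch := arch, primesC := primesC }

/-- geometric tail of the envelope: entries i = Jt .. Kw -/
def geoTail (A : Inp) : Nat → Nat → List Nat → List Nat
  | 0, _, acc => acc
  | fuel + 1, geo, acc => geoTail A fuel (mulU geo A.emhStep) (mulU A.zm1H geo :: acc)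

/-- env list, i = 0..Kw (forward order) -/
def envList (A : Inp) (st : St) : List Nat :=
  st.eRev.reverse ++ (geoTail A (A.Kw + 1 - A.Jt) (powU A.emhStep A.Jt) []).reverse

/-- running pairwise maxima (helper of `emaxList`). [this cell] -/
def emaxAux : Nat → List Nat → List Nat → List Nat
  | _, [], acc => acc
  | prev, e :: es, acc => emaxAux e es (max prev e :: acc)

/-- emax list forward: emax_0 = env_0, emax_k = max(env_{k-1}, env_k) -/
def emaxList (env : List Nat) : List Nat :=
  match env with
  | [] => []
  | e0 :: es => (emaxAux e0 es [e0]).reverse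

/-- exact dot product of two lists (truncated to the shorter). [this cell] -/
def dot : List Nat → List Nat → Nat → Nat
  | a :: as, b :: bs, acc => dot as bs (acc + a * b)
  | _, _, acc => acc

/-- convolution loop over k = 0..Kw-1: G_k = mulU(H_k, eh^k), H_k = mulU(ceil(Σ env_i emax_{k-i} / S), tau); returns G reversed -/
def convLoop (A : Inp) (emax : List Nat) : Nat → List Nat → List Nat → Nat → List Nat → List Nat
  | 0, _, _, _, acc => acc
  | fuel + 1, envRest, revPre, ehk, acc =>
    match envRest with
    | [] => acc
    | e :: es =>
      let revPre' := e :: revPre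
      let s := dot revPre' emax 0
      let Hk := mulU ((s + (S - 1)) / S) A.tau
      convLoop A emax fuel es revPre' (mulU ehk A.ehStep) (mulU Hk ehk :: acc)

/-- decreasing hull from the right: input G reversed, output Gs_0..Gs_{Kw-1} forward -/
def hull : List Nat → Nat → List Nat → List Nat
  | [], _, acc => acc
  | g :: gs, cur, acc => let c := max g cur; hull gs c (c :: acc)

/-- `Σ_k G*_k·(⌈e^{(k+1)τ}⌉ − ⌊e^{kτ}⌋)`. [this cell, THETA-CERT-cc6 E5] -/
def integLoop (A : Inp) : List Nat → Nat → Nat → Nat → Nat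
  | [], _, _, acc => acc
  | g :: gs, ewH, ewL, acc =>
    let ewH1 := mulU ewH A.etH
    let d := if ewH1 ≥ ewL then ewH1 - ewL else 0
    integLoop A gs ewH1 (mulD ewL A.etL) (acc + mulU g d)

/-- The cross term `2·C·M₀²·[G*(0) + Σ_k G*_k(e^{(k+1)τ} − e^{kτ}) + tail]` (E4 convolution + E5 summation by parts). [this cell, THETA-CERT-cc6 E4/E5] -/
def crossTerm (A : Inp) (st : St) : Nat :=
  let env := envList A st
  let emax := emaxList env
  let gRev := convLoop A emax A.Kw env [] S []
  let gs := hull gRev A.GtailW []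
  let gs0 := gs.headD 0
  let integ := integLoop A gs S S 0
  mulU (mulU (2 * A.Cpsi) (mulU A.M0 A.M0)) (gs0 + integ + A.tailInt)

/-- maximum of a list (with a floor `acc`). [this cell] -/
def listMax : List Nat → Nat → Nat
  | [], acc => acc
  | x :: xs, acc => listMax xs (max x acc)

/-- The layer remainder `(2 log q/√q)·(rA·M_L·χ_L + rB·M_L²χ_L²)` with the cellwise `M_L` (v1.1). [this cell, THETA-CERT-cc6 D4/§E] -/
def rTerm (A : Inp) (st : St) : Nat :=
  let sl := st.sRev.reverse
  let sLayer := if A.j1p > A.j0 then listMax ((sl.drop A.j0).take (A.j1p - A.j0)) 0 else A.zm1H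
  let ML := mulU (mulU A.M0 sLayer) A.emL
  let r := mulU (mulU A.rA ML) A.chiL + mulU (mulU (mulU A.rB ML) ML) (mulU A.chiL A.chiL)
  mulU A.rcoef r

/-- lower Riemann sum `Σ_j ⌊⌊δ/J·a_j⌋·b_j⌋`. [this cell, THETA-CERT-cc6 D8] -/
def gainLoop (dJ : Nat) : List (Nat × Nat) → Nat → Nat
  | [], acc => acc
  | (a, b) :: ps, acc => gainLoop dJ ps (acc + mulD (mulD dJ a) b)

/-- `gain ≤ 2 log q · I` (D8, `J` cells). [this cell, THETA-CERT-cc6 D8] -/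
def gainLo (A : Inp) : Nat := mulD (2 * A.logqL) (2 * gainLoop A.dJ A.gainPairs 0)

/-- The checker's outputs (scaled naturals): `loss ≥` the tier-2 loss, `gain ≤ 2 log q·I`, and the four parts + `A`, `B`. [this cell] -/
structure Out where
  loss : Nat
  gain : Nat
  primesC : Nat
  cross : Nat
  arch : Nat
  rterm : Nat
  Ahi : Nat
  Bhi : Nat
deriving DecidableEq

/-- The whole tier-2 arithmetic for one row. [this cell, THETA-CERT-cc6 E6] -/
def run (A : Inp) : Out :=
  let st := stage1 A
  let mid := stage2 A st
  let cross := crossTerm A st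
  let rt := rTerm A st
  { loss := mid.primesC + cross + mid.arch + rt, gain := gainLo A,
    primesC := mid.primesC, cross := cross, arch := mid.arch, rterm := rt, Ahi := mid.Ahi, Bhi := mid.Bhi }

/-- The verdict `loss < gain`. [this cell, THETA-CERT-cc6 E6] -/
def certify (A : Inp) : Bool :=
  let o := run A
  decide (o.loss < o.gain)

/-! ## Kernel smoke tests (milliseconds) -/

/-- `sup |sin|` on `[3, 3.2] ∋ π`: small (≈ sin 0.142). -/
example : sinSup (3 * S) (32 * S / 10) (3141592653589793238 * S / 10 ^ 18) (3141592653589793239 * S / 10 ^ 18) < S / 7 := by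
  decide +kernel

/-- `sup |sin|` on `[1.5, 1.6] ∋ π/2`: exactly the cap `S`. -/
example : sinSup (15 * S / 10) (16 * S / 10) (3141592653589793238 * S / 10 ^ 18) (3141592653589793239 * S / 10 ^ 18) = S := by
  decide +kernel

end Summit.RiemannHypothesis.RiemannHypothesis.Theorems.ThetaTier2
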